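import Mathlib
import Summits.Ventures.PercRepro0.Harris

/-!
# P7 · HARRIS–FKG, corollaries 7.6 and 7.7 on the cell's definitions (seat p3)

Kernel-checked twins of proofs/P7-fkg-p3-v1.md §1 Corollary 7.6 (decreasing and mixed events,
finite families) and Corollary 7.7 (the square-root trick), for the percolation measure `Defs.P d p`
(they hold for any `setBernoulli u p`; stated here on `P d p`, the form blocks P and H consume):

* `P_mul_le_inter_of_isUpperSet` — Theorem 7.5 on `P d p` (restated from `Harris.P7_FKG_holds`);
* `P_mul_le_inter_of_isLowerSet` — Cor 7.6(a): two decreasing events;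
* `P_inter_le_mul_of_isUpperSet_isLowerSet` — Cor 7.6(b): increasing × decreasing;
* `prod_le_P_iInter_of_isUpperSet` / `…_isLowerSet` — Cor 7.6(c): a finite family, all increasing
  (all decreasing): `Π P(A_j) ≤ P(⋂ A_j)`;
* `one_sub_pow_le_of_isUpperSet` — Cor 7.7: all increasing, `P(A_j) = q` for `j ∈ s` ⇒
  `(1 − q)^|s| ≤ 1 − P(⋃ A_j)` (the square-root trick in its polynomial form; the `k`-th root is
  taken by the consumer), and the same for decreasing families.
All events are measurable; complements of increasing events are decreasing (`IsUpperSet.compl`).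
-/

namespace Summit.Ventures.PercRepro0.Harris

open MeasureTheory ProbabilityTheory unitInterval Set Defs
open scoped ENNReal

variable {d : ℕ} (p : I)

/-- Theorem 7.5 on the percolation measure: `P_p(A) P_p(B) ≤ P_p(A ∩ B)` for increasing
measurable `A`, `B`. -/
theorem P_mul_le_inter_of_isUpperSet {A B : Set (Config d)} (hA : IsUpperSet A) (hB : IsUpperSet B)
    (mA : MeasurableSet A) (mB : MeasurableSet B) : P d p A * P d p B ≤ P d p (A ∩ B) :=
  P7_FKG_holds d p A B hA hB mA mB

/-- Real form of Theorem 7.5 on the percolation measure. -/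
theorem real_mul_le_inter_of_isUpperSet {A B : Set (Config d)} (hA : IsUpperSet A)
    (hB : IsUpperSet B) (mA : MeasurableSet A) (mB : MeasurableSet B) :
    (P d p).real A * (P d p).real B ≤ (P d p).real (A ∩ B) :=
  real_mul_le_real_inter (bonds d) p hA hB mA mB

/-- Cor 7.6(a): two decreasing measurable events are positively correlated. -/
theorem real_mul_le_inter_of_isLowerSet {A B : Set (Config d)} (hA : IsLowerSet A)
    (hB : IsLowerSet B) (mA : MeasurableSet A) (mB : MeasurableSet B) :
    (P d p).real A * (P d p).real B ≤ (P d p).real (A ∩ B) := by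
  have h := real_mul_le_inter_of_isUpperSet p hA.compl hB.compl mA.compl mB.compl
  have hU : (P d p).real (Aᶜ ∩ Bᶜ) = 1 - (P d p).real (A ∪ B) := by
    rw [← compl_union, probReal_compl_eq_one_sub (mA.union mB)]
  have hAB : (P d p).real (A ∪ B) + (P d p).real (A ∩ B) = (P d p).real A + (P d p).real B :=
    measureReal_union_add_inter (μ := P d p) (s := A) mB
  rw [probReal_compl_eq_one_sub mA, probReal_compl_eq_one_sub mB, hU] at h
  nlinarith [h, hAB]

/-- Cor 7.6(a), measure form. -/
theorem P_mul_le_inter_of_isLowerSet {A B : Set (Config d)} (hA : IsLowerSet A) (hB : IsLowerSet B)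
    (mA : MeasurableSet A) (mB : MeasurableSet B) : P d p A * P d p B ≤ P d p (A ∩ B) := by
  have h := real_mul_le_inter_of_isLowerSet p hA hB mA mB
  simp only [measureReal_def] at h
  rw [← ENNReal.toReal_mul] at h
  exact (ENNReal.toReal_le_toReal (ENNReal.mul_ne_top (measure_ne_top _ _) (measure_ne_top _ _))
    (measure_ne_top _ _)).1 h

/-- Cor 7.6(b): an increasing and a decreasing event are negatively correlated. -/
theorem real_inter_le_mul_of_isUpperSet_isLowerSet {A B : Set (Config d)} (hA : IsUpperSet A)
    (hB : IsLowerSet B) (mA : MeasurableSet A) (mB : MeasurableSet B) :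
    (P d p).real (A ∩ B) ≤ (P d p).real A * (P d p).real B := by
  have h := real_mul_le_inter_of_isUpperSet p hA hB.compl mA mB.compl
  have hsplit : (P d p).real (A ∩ B) + (P d p).real (A ∩ Bᶜ) = (P d p).real A := by
    have := measureReal_inter_add_sdiff (μ := P d p) (s := A) mB
    rwa [Set.sdiff_eq] at this
  rw [probReal_compl_eq_one_sub mB] at h
  nlinarith [h, hsplit]

/-- Cor 7.6(b), measure form. -/
theorem P_inter_le_mul_of_isUpperSet_isLowerSet {A B : Set (Config d)} (hA : IsUpperSet A)
    (hB : IsLowerSet B) (mA : MeasurableSet A) (mB : MeasurableSet B) :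
    P d p (A ∩ B) ≤ P d p A * P d p B := by
  have h := real_inter_le_mul_of_isUpperSet_isLowerSet p hA hB mA mB
  simp only [measureReal_def] at h
  rw [← ENNReal.toReal_mul] at h
  exact (ENNReal.toReal_le_toReal (measure_ne_top _ _)
    (ENNReal.mul_ne_top (measure_ne_top _ _) (measure_ne_top _ _))).1 h

/-- Cor 7.6(c): for a finite family of increasing measurable events, `Π_j P(A_j) ≤ P(⋂_j A_j)`. -/
theorem prod_le_real_iInter_of_isUpperSet {ι : Type*} (s : Finset ι) (A : ι → Set (Config d))
    (hA : ∀ j ∈ s, IsUpperSet (A j)) (mA : ∀ j ∈ s, MeasurableSet (A j)) :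
    ∏ j ∈ s, (P d p).real (A j) ≤ (P d p).real (⋂ j ∈ s, A j) := by
  classical
  induction s using Finset.induction_on with
  | empty => simp
  | insert j s hj ih =>
    have hs : ∀ j ∈ s, IsUpperSet (A j) := fun j hj => hA j (Finset.mem_insert_of_mem hj)
    have ms : ∀ j ∈ s, MeasurableSet (A j) := fun j hj => mA j (Finset.mem_insert_of_mem hj)
    have hI : IsUpperSet (⋂ i ∈ s, A i) := isUpperSet_iInter₂ fun i hi => hs i hi
    have mI : MeasurableSet (⋂ i ∈ s, A i) := Finset.measurableSet_biInter s ms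
    rw [Finset.prod_insert hj, Finset.set_biInter_insert]
    calc (P d p).real (A j) * ∏ i ∈ s, (P d p).real (A i)
        ≤ (P d p).real (A j) * (P d p).real (⋂ i ∈ s, A i) :=
          mul_le_mul_of_nonneg_left (ih hs ms) measureReal_nonneg
      _ ≤ (P d p).real (A j ∩ ⋂ i ∈ s, A i) :=
          real_mul_le_inter_of_isUpperSet p (hA j (Finset.mem_insert_self j s)) hI
            (mA j (Finset.mem_insert_self j s)) mI

/-- Cor 7.6(c) for decreasing families. -/
theorem prod_le_real_iInter_of_isLowerSet {ι : Type*} (s : Finset ι) (A : ι → Set (Config d))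
    (hA : ∀ j ∈ s, IsLowerSet (A j)) (mA : ∀ j ∈ s, MeasurableSet (A j)) :
    ∏ j ∈ s, (P d p).real (A j) ≤ (P d p).real (⋂ j ∈ s, A j) := by
  classical
  induction s using Finset.induction_on with
  | empty => simp
  | insert j s hj ih =>
    have hs : ∀ j ∈ s, IsLowerSet (A j) := fun j hj => hA j (Finset.mem_insert_of_mem hj)
    have ms : ∀ j ∈ s, MeasurableSet (A j) := fun j hj => mA j (Finset.mem_insert_of_mem hj)
    have hI : IsLowerSet (⋂ i ∈ s, A i) := isLowerSet_iInter₂ fun i hi => hs i hi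
    have mI : MeasurableSet (⋂ i ∈ s, A i) := Finset.measurableSet_biInter s ms
    rw [Finset.prod_insert hj, Finset.set_biInter_insert]
    calc (P d p).real (A j) * ∏ i ∈ s, (P d p).real (A i)
        ≤ (P d p).real (A j) * (P d p).real (⋂ i ∈ s, A i) :=
          mul_le_mul_of_nonneg_left (ih hs ms) measureReal_nonneg
      _ ≤ (P d p).real (A j ∩ ⋂ i ∈ s, A i) :=
          real_mul_le_inter_of_isLowerSet p (hA j (Finset.mem_insert_self j s)) hI
            (mA j (Finset.mem_insert_self j s)) mI

/-- Cor 7.7 (square-root trick, polynomial form): for a finite family of increasing measurable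
events with `P(A_j) = q` for every `j ∈ s`, `(1 − q)^|s| ≤ 1 − P(⋃_j A_j)`. -/
theorem one_sub_pow_le_of_isUpperSet {ι : Type*} (s : Finset ι) (A : ι → Set (Config d))
    (hA : ∀ j ∈ s, IsUpperSet (A j)) (mA : ∀ j ∈ s, MeasurableSet (A j)) {q : ℝ}
    (hq : ∀ j ∈ s, (P d p).real (A j) = q) :
    (1 - q) ^ s.card ≤ 1 - (P d p).real (⋃ j ∈ s, A j) := by
  have h := prod_le_real_iInter_of_isLowerSet p s (fun j => (A j)ᶜ) (fun j hj => (hA j hj).compl)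
    (fun j hj => (mA j hj).compl)
  have hc : ∀ j ∈ s, (P d p).real (A j)ᶜ = 1 - q := fun j hj => by
    rw [probReal_compl_eq_one_sub (mA j hj), hq j hj]
  rw [Finset.prod_congr rfl hc, Finset.prod_const] at h
  have hU : (⋂ j ∈ s, (A j)ᶜ) = (⋃ j ∈ s, A j)ᶜ := by
    ext ω; simp
  rw [hU, probReal_compl_eq_one_sub (Finset.measurableSet_biUnion s mA)] at h
  exact h

/-- Cor 7.7 for decreasing families. -/
theorem one_sub_pow_le_of_isLowerSet {ι : Type*} (s : Finset ι) (A : ι → Set (Config d))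
    (hA : ∀ j ∈ s, IsLowerSet (A j)) (mA : ∀ j ∈ s, MeasurableSet (A j)) {q : ℝ}
    (hq : ∀ j ∈ s, (P d p).real (A j) = q) :
    (1 - q) ^ s.card ≤ 1 - (P d p).real (⋃ j ∈ s, A j) := by
  have h := prod_le_real_iInter_of_isUpperSet p s (fun j => (A j)ᶜ) (fun j hj => (hA j hj).compl)
    (fun j hj => (mA j hj).compl)
  have hc : ∀ j ∈ s, (P d p).real (A j)ᶜ = 1 - q := fun j hj => by
    rw [probReal_compl_eq_one_sub (mA j hj), hq j hj]
  rw [Finset.prod_congr rfl hc, Finset.prod_const] at h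
  have hU : (⋂ j ∈ s, (A j)ᶜ) = (⋃ j ∈ s, A j)ᶜ := by
    ext ω; simp
  rw [hU, probReal_compl_eq_one_sub (Finset.measurableSet_biUnion s mA)] at h
  exact h

end Summit.Ventures.PercRepro0.Harris
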